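import Literature.Computability.Complexity.CircuitDAG
import HarnessLib

/-!
# Symmetric threshold programs

A calculus for building SYMMETRIC threshold circuits (Anderson–Dawar 2017, §2–3; Dawar–Wilsenach
2025, §3) without touching wires, argument tuples or topological orders.

A `SymProg ι Λ` is a specification of a threshold circuit at the level of LOGICAL gates `l : Λ`:
each gate has a kind (`and`, `or`, `nor`, `atLeast t`), a finite SET of source wires
`srcs l : Finset (ι ⊕ Λ)` (inputs or other logical gates) and a rank, sources having smaller rank.
Its semantics `P.sem x : Λ → Bool` is the obvious recursive truth assignment (`sem_and`, `sem_or`,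
`sem_nor`, `sem_atLeast`).  The companion file `SymmetricThresholdProgramsDAG.lean` realises the
program as a `GateDAG` over the threshold basis `tcBasis` with `2·|Λ| + 2` physical gates (a padded
majority gate and a unary post-gate per logical gate, two constants), whose value at the output
wire is the semantics (`SymProg.evalOut_toDAG`, `SymProg.compile_toDAG_eval`).

The point of the calculus is the second companion `SymmetricThresholdProgramsSymmetry.lean`: because
sources are SETS, a relabelling `θ : Λ ≃ Λ` of the logical gates over an input map `π : ι → ι` that
preserves kinds and maps source sets to source sets is automatically an automorphism of the
realised DAG, so equivariantly indexed programs compile to symmetric circuits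
(`SymProg.hasSymCircuit`), and their semantics is invariant (`SymProg.sem_symm`).  This is the
"routine symmetric compilation" step of FPC-to-circuit translations (Anderson–Dawar 2017, §3),
packaged once and for all.

## References
* M. Anderson, A. Dawar, *On symmetric circuits and fixed-point logics*, Theory Comput. Syst. 60
  (2017), §2–3 [AndersonDawar2016].
* A. Dawar, G. Wilsenach, *Symmetric arithmetic circuits*, ToC 2025, §3 [DawarWilsenach2025].
* H. Vollmer, *Introduction to Circuit Complexity*, Springer 1999, §1.1 (threshold and majority
  gates) [Vollmer1999].
-/

namespace Literature.Computability.Complexity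

open Finset

/-- The kinds of logical gates of a symmetric threshold program: conjunction, disjunction and
negated disjunction of the sources, and the counting gate "at least `t` sources are true".
[cite: Vollmer1999, §1.1] -/
inductive SymProg.Kind
  | and
  | or
  | nor
  | atLeast (t : ℕ)
  deriving DecidableEq

namespace SymProg.Kind

/-- The threshold realising a kind on `n` sources: the (pre-)gate fires iff at least `thr κ n`
sources are true. [folklore] -/
def thr : Kind → ℕ → ℕ
  | and, n => n
  | or, _ => 1
  | nor, _ => 1
  | atLeast t, _ => t

/-- Whether the kind negates its threshold test (`nor` only). [folklore] -/
def neg : Kind → Bool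
  | nor => true
  | _ => false

/-- The truth table of a kind on `n` sources of which `c` are true. [folklore] -/
def dec : Kind → ℕ → ℕ → Bool
  | and, n, c => decide (n ≤ c)
  | or, _, c => decide (1 ≤ c)
  | nor, _, c => decide (c = 0)
  | atLeast t, _, c => decide (t ≤ c)

/-- The truth table in terms of threshold and negation flag. [folklore] -/
theorem dec_eq (κ : Kind) (n c : ℕ) :
    κ.dec n c = if κ.neg then !decide (κ.thr n ≤ c) else decide (κ.thr n ≤ c) := by
  cases κ with
  | and => simp [dec, neg, thr]
  | or => simp [dec, neg, thr]
  | nor =>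
    simp only [dec, neg, thr, if_true]
    cases c <;> simp
  | atLeast t => simp [dec, neg, thr]

end SymProg.Kind

/-- A **symmetric threshold program** over the inputs `ι` with logical gates `Λ`: every logical
gate has a kind, a finite set of source wires (inputs `Sum.inl i` or gates `Sum.inr l'`) and a
rank, and gate sources have strictly smaller rank (acyclicity). [cite: AndersonDawar2016, Def. 4] -/
structure SymProg (ι Λ : Type*) where
  /-- the kind of a logical gate -/
  kind : Λ → SymProg.Kind
  /-- the set of source wires of a logical gate -/
  srcs : Λ → Finset (ι ⊕ Λ)
  /-- a rank function -/
  rank : Λ → ℕ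
  /-- gate sources have smaller rank -/
  rank_lt : ∀ l l', Sum.inr l' ∈ srcs l → rank l' < rank l

namespace SymProg

variable {ι Λ : Type*} (P : SymProg ι Λ)

/-! ### Semantics -/

section Semantics

/-- The value of a logical wire, given the input and the values of the logical gates. [folklore] -/
def wval (x : ι → Bool) (v : Λ → Bool) : ι ⊕ Λ → Bool := Sum.elim x v

/-- Value of an input wire. [folklore] -/
@[simp] theorem wval_inl (x : ι → Bool) (v : Λ → Bool) (i : ι) : wval x v (Sum.inl i) = x i := rfl

/-- Value of a gate wire. [folklore] -/
@[simp] theorem wval_inr (x : ι → Bool) (v : Λ → Bool) (l : Λ) : wval x v (Sum.inr l) = v l := rfl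

/-- The number of true sources of `l`. [folklore] -/
def cnt (x : ι → Bool) (v : Λ → Bool) (l : Λ) : ℕ :=
  ((P.srcs l).filter fun w => wval x v w = true).card

/-- One evaluation step: the truth table of `l` applied to the values `v` of its sources. [folklore] -/
def step (x : ι → Bool) (v : Λ → Bool) (l : Λ) : Bool :=
  (P.kind l).dec (P.srcs l).card (P.cnt x v l)

/-- The count of true sources only depends on the values of the sources. [folklore] -/
theorem cnt_congr {x : ι → Bool} {v v' : Λ → Bool} {l : Λ}
    (h : ∀ l', Sum.inr l' ∈ P.srcs l → v l' = v' l') : P.cnt x v l = P.cnt x v' l := by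
  unfold cnt
  congr 1
  refine Finset.filter_congr fun w hw => ?_
  cases w with
  | inl i => rfl
  | inr l' => rw [wval_inr, wval_inr, h l' hw]

/-- A step only depends on the values of the sources. [folklore] -/
theorem step_congr {x : ι → Bool} {v v' : Λ → Bool} {l : Λ}
    (h : ∀ l', Sum.inr l' ∈ P.srcs l → v l' = v' l') : P.step x v l = P.step x v' l := by
  unfold step; rw [P.cnt_congr h]

/-- Fuelled evaluation: `approx x n` is correct on gates of rank `< n`. [folklore] -/
def approx (x : ι → Bool) : ℕ → Λ → Bool
  | 0 => fun _ => false
  | n + 1 => P.step x (approx x n)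

/-- **The semantics** of the program: the value of the logical gate `l` on input `x`. [folklore] -/
def sem (x : ι → Bool) (l : Λ) : Bool := P.approx x (P.rank l + 1) l

/-- Enough fuel computes the semantics. [folklore] -/
theorem approx_eq_sem (x : ι → Bool) : ∀ n l, P.rank l < n → P.approx x n l = P.sem x l := by
  intro n
  induction n using Nat.strong_induction_on with
  | _ n ih =>
    intro l hl
    cases n with
    | zero => exact absurd hl (Nat.not_lt_zero _)
    | succ n =>
      show P.step x (P.approx x n) l = P.step x (P.approx x (P.rank l)) l
      refine P.step_congr fun l' hl' => ?_
      have hr := P.rank_lt l l' hl'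
      rw [ih n (Nat.lt_succ_self n) l' (by omega), ih (P.rank l) (by omega) l' hr]

/-- **The defining equation of the semantics.** [folklore] -/
theorem sem_eq (x : ι → Bool) (l : Λ) : P.sem x l = P.step x (P.sem x) l := by
  show P.step x (P.approx x (P.rank l)) l = _
  exact P.step_congr fun l' hl' => P.approx_eq_sem x _ _ (P.rank_lt l l' hl')

/-- The semantics through the truth table of the kind. [folklore] -/
theorem sem_eq_dec (x : ι → Bool) (l : Λ) :
    P.sem x l = (P.kind l).dec (P.srcs l).card (P.cnt x (P.sem x) l) :=
  P.sem_eq x l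

/-- The number of true sources is at most the number of sources. [folklore] -/
theorem cnt_le_card (x : ι → Bool) (v : Λ → Bool) (l : Λ) : P.cnt x v l ≤ (P.srcs l).card :=
  Finset.card_filter_le _ _

/-- **Conjunction gates.** [folklore] -/
theorem sem_and {x : ι → Bool} {l : Λ} (h : P.kind l = Kind.and) :
    P.sem x l = true ↔ ∀ w ∈ P.srcs l, wval x (P.sem x) w = true := by
  rw [P.sem_eq_dec, h, Kind.dec, decide_eq_true_iff]
  unfold cnt
  rw [← Finset.card_filter_eq_iff]
  exact ⟨fun h1 => le_antisymm (Finset.card_filter_le _ _) h1, fun h1 => h1.ge⟩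

/-- **Disjunction gates.** [folklore] -/
theorem sem_or {x : ι → Bool} {l : Λ} (h : P.kind l = Kind.or) :
    P.sem x l = true ↔ ∃ w ∈ P.srcs l, wval x (P.sem x) w = true := by
  rw [P.sem_eq_dec, h, Kind.dec, decide_eq_true_iff, Nat.one_le_iff_ne_zero, cnt, Ne,
    Finset.card_eq_zero, ← Ne, ← Finset.nonempty_iff_ne_empty, Finset.filter_nonempty_iff]

/-- **Negated disjunction gates.** [folklore] -/
theorem sem_nor {x : ι → Bool} {l : Λ} (h : P.kind l = Kind.nor) :
    P.sem x l = true ↔ ∀ w ∈ P.srcs l, wval x (P.sem x) w = false := by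
  rw [P.sem_eq_dec, h, Kind.dec, decide_eq_true_iff, cnt, Finset.card_eq_zero,
    Finset.filter_eq_empty_iff]
  simp only [Bool.not_eq_true]

/-- **Counting gates.** [folklore] -/
theorem sem_atLeast {x : ι → Bool} {l : Λ} {t : ℕ} (h : P.kind l = Kind.atLeast t) :
    P.sem x l = true ↔ t ≤ ((P.srcs l).filter fun w => wval x (P.sem x) w = true).card := by
  rw [P.sem_eq_dec, h, Kind.dec, decide_eq_true_iff]; rfl

/-- A negation: a `nor` gate with a single source. [folklore] -/
theorem sem_nor_singleton {x : ι → Bool} {l : Λ} (h : P.kind l = Kind.nor) {w : ι ⊕ Λ}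
    (hw : P.srcs l = {w}) : P.sem x l = !(wval x (P.sem x) w) := by
  rw [Bool.eq_iff_iff, P.sem_nor h, hw]
  simp

end Semantics

end SymProg

end Literature.Computability.Complexity
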